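import Mathlib
import HarnessLib
import Literature.Analysis.FluidPDE.AxisymHouLiVariables
import Summits.NavierStokesRegularity.NavierStokesRegularity.Theorems.TypeIQuarterGateScarEnvelopeTypeIForcedTsaiFieldCalculus
import Summits.NavierStokesRegularity.NavierStokesRegularity.Theorems.TypeIQuarterGateScarEnvelopeTypeIForcedTsaiFieldSmooth

/-!
# ARM B lane E-exact — the witness field is divergence-free (second half of stub S1); S1 DISCHARGED

`div (curl Ψ) = 0` for the explicit witness `U = e^{−a|y|²}·curl_a p`, at the level of the checker's
SYMBOLIC operators: the value of `Dg b i` depends on a polynomial only through its value function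
(`eval_Dg_congr`, so `norm` is invisible), is additive (`eval_Dg_sub`), and two `Dg`'s COMMUTE at the value
level (`eval_Dg_comm`, from the symmetry of second derivatives of the smooth function `y ↦ Q(y)`,
Mathlib `ContDiffAt.isSymmSndFDerivAt`).  With `divergence_eq_sum_three` and `fderiv_field_single` the
divergence is `e^{−a|y|²}·Σ_cyc (Dg_i Dg_j − Dg_j Dg_i) p_k = 0`.  Then
`WitnessRow.field_smooth_divFree` = stub S1.  Nothing here bears on NS regularity.
-/

noncomputable section

set_option linter.dupNamespace false

namespace Summit.NavierStokesRegularity.NavierStokesRegularity.Cruxes.ScarEnvelopeTypeI.ForcedTsai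

open scoped ContDiff
open Literature.Analysis.FluidPDE

/-- `e_j` as a vector of `ℝ³`. -/
abbrev eb (j : Fin 3) : E3 := EuclideanSpace.single j (1 : ℝ)

/-- The symbolic derivative's value is the directional derivative of the value function. -/
theorem QPoly.eval_deriv_eq_fderiv (j : Fin 3) (Q : QPoly) (y : E3) :
    QPoly.eval (QPoly.deriv j Q) y = fderiv ℝ (fun y => QPoly.eval Q y) y (eb j) :=
  (QPoly.fderiv_eval_single Q y j).symm

/-- `Dg` through the value function: `(Dg b i Q)(y) = ∂_i Q(y) − 2b y_i Q(y)`. -/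
theorem eval_Dg_fderiv (b : ℚ) (i : Fin 3) (Q : QPoly) (y : E3) :
    QPoly.eval (Dg b i Q) y = fderiv ℝ (fun y => QPoly.eval Q y) y (eb i) - 2 * (b : ℝ) * y i * QPoly.eval Q y := by
  rw [eval_Dg, QPoly.eval_deriv_eq_fderiv]

/-- `Dg` sees a polynomial only through its value function. -/
theorem eval_Dg_congr (b : ℚ) (i : Fin 3) {Q Q' : QPoly} (h : ∀ y, QPoly.eval Q y = QPoly.eval Q' y) (y : E3) :
    QPoly.eval (Dg b i Q) y = QPoly.eval (Dg b i Q') y := by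
  have hf : (fun y => QPoly.eval Q y) = fun y => QPoly.eval Q' y := funext h
  rw [eval_Dg_fderiv, eval_Dg_fderiv, hf, h y]

/-- `Dg` is additive (value level). -/
theorem eval_Dg_sub (b : ℚ) (i : Fin 3) (A B : QPoly) (y : E3) :
    QPoly.eval (Dg b i (QPoly.sub A B)) y = QPoly.eval (Dg b i A) y - QPoly.eval (Dg b i B) y := by
  rw [eval_Dg_fderiv, eval_Dg_fderiv, eval_Dg_fderiv]
  have hf : (fun y => QPoly.eval (QPoly.sub A B) y) = (fun y => QPoly.eval A y) - fun y => QPoly.eval B y := by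
    funext y; simp
  rw [hf, fderiv_sub (QPoly.differentiableAt_eval A y) (QPoly.differentiableAt_eval B y), QPoly.eval_sub]
  simp only [FunLike.coe_sub, Pi.sub_apply]
  ring

/-- Symmetry of the symbolic second derivatives (value level), from Schwarz for `y ↦ Q(y)`. -/
theorem QPoly.eval_deriv_comm (Q : QPoly) (i j : Fin 3) (y : E3) :
    QPoly.eval (QPoly.deriv i (QPoly.deriv j Q)) y = QPoly.eval (QPoly.deriv j (QPoly.deriv i Q)) y := by
  set g : E3 → ℝ := fun y => QPoly.eval Q y with hg_def
  have hg : ContDiff ℝ ∞ g := QPoly.contDiff_eval Q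
  have hdg : Differentiable ℝ (fderiv ℝ g) :=
    (hg.fderiv_right (m := ∞) (by simp)).differentiable (by simp)
  have key : ∀ k l : Fin 3, QPoly.eval (QPoly.deriv k (QPoly.deriv l Q)) y = fderiv ℝ (fderiv ℝ g) y (eb k) (eb l) := by
    intro k l
    rw [QPoly.eval_deriv_eq_fderiv]
    have hfun : (fun y => QPoly.eval (QPoly.deriv l Q) y) = fun y => fderiv ℝ g y (eb l) :=
      funext fun y => QPoly.eval_deriv_eq_fderiv l Q y
    rw [hfun, fderiv_clm_apply (hdg y) (differentiableAt_const _)]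
    simp
  rw [key, key]
  have hg2 : ContDiff ℝ 2 g := QPoly.contDiff_eval Q
  exact (hg2.contDiffAt.isSymmSndFDerivAt (by simp)) (eb i) (eb j)

/-- Second symbolic Gaussian derivative, expanded at the value level. -/
theorem eval_Dg_Dg (b : ℚ) (i j : Fin 3) (Q : QPoly) (y : E3) :
    QPoly.eval (Dg b i (Dg b j Q)) y =
      QPoly.eval (QPoly.deriv i (QPoly.deriv j Q)) y
        - 2 * (b : ℝ) * (if j = i then QPoly.eval Q y else 0)
        - 2 * (b : ℝ) * y j * QPoly.eval (QPoly.deriv i Q) y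
        - 2 * (b : ℝ) * y i * (QPoly.eval (QPoly.deriv j Q) y - 2 * (b : ℝ) * y j * QPoly.eval Q y) := by
  rw [eval_Dg, eval_Dg, QPoly.eval_deriv_eq_fderiv i (Dg b j Q)]
  have hF : (fun y => QPoly.eval (Dg b j Q) y) =
      (fun y => QPoly.eval (QPoly.deriv j Q) y) + fun y => (-2 * (b : ℝ)) * (y j * QPoly.eval Q y) := by
    funext y; rw [Pi.add_apply, eval_Dg]; ring
  have hd1 : DifferentiableAt ℝ (fun y => QPoly.eval (QPoly.deriv j Q) y) y := QPoly.differentiableAt_eval _ y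
  have hcj : HasFDerivAt (fun y : E3 => y j) (EuclideanSpace.proj j : E3 →L[ℝ] ℝ) y :=
    (EuclideanSpace.proj j : E3 →L[ℝ] ℝ).hasFDerivAt
  have hcoord : DifferentiableAt ℝ (fun y : E3 => y j) y := hcj.differentiableAt
  have hd2 : DifferentiableAt ℝ (fun y : E3 => y j * QPoly.eval Q y) y := hcoord.mul (QPoly.differentiableAt_eval Q y)
  rw [hF, fderiv_add hd1 (hd2.const_mul _)]
  simp only [FunLike.coe_add, Pi.add_apply]
  rw [QPoly.fderiv_eval_single, fderiv_const_mul hd2]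
  simp only [FunLike.coe_smul, Pi.smul_apply, smul_eq_mul]
  rw [show (fun y : E3 => y j * QPoly.eval Q y) = (fun y : E3 => y j) * fun y => QPoly.eval Q y from rfl,
    fderiv_mul hcoord (QPoly.differentiableAt_eval Q y)]
  simp only [FunLike.coe_add, FunLike.coe_smul, Pi.add_apply, Pi.smul_apply, smul_eq_mul]
  rw [QPoly.fderiv_eval_single, hcj.fderiv, proj_single]
  split_ifs with h
  · subst h; ring
  · ring

/-- **Two symbolic Gaussian derivatives commute (value level).** -/
theorem eval_Dg_comm (b : ℚ) (i j : Fin 3) (Q : QPoly) (y : E3) :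
    QPoly.eval (Dg b i (Dg b j Q)) y = QPoly.eval (Dg b j (Dg b i Q)) y := by
  rw [eval_Dg_Dg, eval_Dg_Dg, QPoly.eval_deriv_comm Q i j y]
  by_cases h : i = j
  · subst h; ring
  · rw [if_neg (Ne.symm h), if_neg h]; ring

namespace WitnessRow

/-- The divergence of the witness field, through the symbolic operators. -/
theorem divergence_field (r : WitnessRow) (y : E3) :
    VectorCalculus.divergence r.field y =
      gauss r.aR y * (QPoly.eval (Dg r.a 0 (r.u 0)) y + QPoly.eval (Dg r.a 1 (r.u 1)) y +
        QPoly.eval (Dg r.a 2 (r.u 2)) y) := by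
  rw [divergence_eq_sum_three, r.fderiv_field_single y 0 0, r.fderiv_field_single y 1 1,
    r.fderiv_field_single y 2 2]
  ring

/-- **The witness field is divergence-free**: `div curl = 0` at the symbolic level. -/
theorem isDivFree_field (r : WitnessRow) : VectorCalculus.IsDivFree r.field := by
  intro y
  rw [r.divergence_field y]
  -- u = curl_a p, componentwise (values; `norm` invisible)
  have hu0 : ∀ z, QPoly.eval (r.u 0) z = QPoly.eval (QPoly.sub (Dg r.a 1 (r.p 2)) (Dg r.a 2 (r.p 1))) z := by
    intro z; simp [WitnessRow.u, curlG]
  have hu1 : ∀ z, QPoly.eval (r.u 1) z = QPoly.eval (QPoly.sub (Dg r.a 2 (r.p 0)) (Dg r.a 0 (r.p 2))) z := by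
    intro z; simp [WitnessRow.u, curlG]
  have hu2 : ∀ z, QPoly.eval (r.u 2) z = QPoly.eval (QPoly.sub (Dg r.a 0 (r.p 1)) (Dg r.a 1 (r.p 0))) z := by
    intro z; simp [WitnessRow.u, curlG]
  rw [eval_Dg_congr r.a 0 hu0, eval_Dg_congr r.a 1 hu1, eval_Dg_congr r.a 2 hu2, eval_Dg_sub, eval_Dg_sub,
    eval_Dg_sub, eval_Dg_comm r.a 0 1 (r.p 2), eval_Dg_comm r.a 1 2 (r.p 0), eval_Dg_comm r.a 2 0 (r.p 1)]
  ring

/-- **S1 (DISCHARGED): the witness field is smooth and divergence-free.** -/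
theorem field_smooth_divFree (r : WitnessRow) : ContDiff ℝ ∞ r.field ∧ VectorCalculus.IsDivFree r.field :=
  ⟨r.contDiff_field, r.isDivFree_field⟩

end WitnessRow

end Summit.NavierStokesRegularity.NavierStokesRegularity.Cruxes.ScarEnvelopeTypeI.ForcedTsai

end
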